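import Summits.BirchSwinnertonDyer.BirchSwinnertonDyer.Theorems.ManinLocalTwoThreeGammaOneIndexFour
import Literature.NumberTheory.EllipticCurves.PeriodLatticeGamma1QuotientProofs
import Literature.NumberTheory.EllipticCurves.ManinConstantGamma1Gamma0LedgerProofs
import Mathlib.RingTheory.ZMod.UnitsCyclic
import HarnessLib

/-!
# At level `N = 4p` the Shimura quotient of an optimal curve is `0` or `ℤ/2`: index `4` (E-an-68's case) never occurs,
# and «doubling» `|c₀| = 2|c₁|` forces index exactly `2` with an explicit generating period

Summit `BirchSwinnertonDyer`, route `ManinLocalTwoThree` (cell bsd-f2-manin), deciding crux C2 `ManinOddAtFour`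
(stmt-BirchSwinnertonDyer-22967): the TAME BLIND residual lives at the levels `N = 4p` (`p = m² + 4` prime; stubs
`stub_blindTameOptimalOddDegree` / an rows E-an-66/67/73/74).  Inputs (tree theorems): the Shimura quotient
`Λ₀(f)/Λ₁(f)` is a quotient of `(ℤ/N)ˣ/{±1}` and at `N = 4q` (`q` odd, `(ℤ/q)ˣ` cyclic) has at most two classes
(`Literature/…/PeriodLatticeGamma1QuotientProofs.lean`, p631564), the ledger `c₁ ∣ c₀ ∣ 2c₁`
(`…/ManinConstantGamma1Gamma0LedgerProofs.lean`, p629489) and the homothety engine (`…GammaOneIndexFour.lean`, p629755).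

* `not_periodLatticeGamma1_eq_two_mul_of_four_mul` — for a lattice-optimal `X₀(4q)`-datum `D₀` (so `Λ₀(f) = c₀⁻¹Λ_{E₀}`
  has rank `2`): `Λ₁(f) ≠ 2Λ₀(f)` — the index-`4` configuration of E-an-68 is IMPOSSIBLE at these levels (pigeonhole
  on the three non-zero classes of `Λ₀/2Λ₀` against the two classes of `Λ₀/Λ₁`, then `ω/2 ∉ Λ_{E₀}`).
* `periodLatticeGamma1_eq_or_exists_generator_of_four_mul` — DICHOTOMY: `Λ₁(f) = Λ₀(f)`, or `[Λ₀ : Λ₁] = 2` with an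
  explicit generating period `{∞, γ₀∞}_f ∉ Λ₁(f)` (`Λ₀ = Λ₁ ⊔ ({∞, γ₀∞}_f + Λ₁)`).
* `natAbs_maninConstant₀_eq_or_index_two_of_four_mul` — for the optimal pair `(D₁, D₀)` of a class at `N = 4q`:
  `|c₀| = |c₁|`, or (`|c₀| = 2|c₁|` AND the Shimura quotient is `ℤ/2` with generator `{∞, γ₀∞}_f`); prime form
  `…_of_four_mul_prime` (`q = p` an odd prime, Mathlib `ZMod.isCyclic_units_prime`).

HONEST FRAMING: structure only — which alternative holds (the Néron bit «doubling ⟹ a non-blind rational 2-torsion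
point») stays open; C2 is not proved; Manin's conjecture is not proved; BSD is not proved by this.  No definitions.
-/

set_option autoImplicit false
-- the summit-side namespace `Summit.BirchSwinnertonDyer.BirchSwinnertonDyer.…` is the tree's (summit = sub-problem)
set_option linter.dupNamespace false

noncomputable section

open WeierstrassCurve Literature.NumberTheory.EllipticCurves Literature.NumberTheory.EllipticCurves.ModularForms
open CongruenceSubgroup

namespace Summit.BirchSwinnertonDyer.BirchSwinnertonDyer.Theorems.ManinLocalTwoThree

variable {W₁ W₀ : WeierstrassCurve ℚ} [W₁.IsElliptic] [W₁.IsGloballyMinimal] [W₀.IsElliptic]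
  [W₀.IsGloballyMinimal] {q : ℕ} [NeZero (4 * q)]

omit [W₀.IsElliptic] [W₀.IsGloballyMinimal] in
/-- For a lattice-optimal datum, `ω/c₀ ∈ Λ₀(f)` for every Néron period `ω ∈ Λ_{E₀}`. -/
theorem div_maninConstant_mem_periodLattice_of_optimal {N : ℕ} [NeZero N] (D₀ : ModularParametrizationData W₀ N)
    (h₀ : ∀ z ∈ D₀.L.lattice, ∃ w ∈ periodLattice D₀.f, z = D₀.c * w) {ω : ℂ} (hω : ω ∈ D₀.L.lattice) :
    ω / (D₀.c : ℂ) ∈ periodLattice D₀.f := by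
  have hc₀ : (D₀.c : ℂ) ≠ 0 := by exact_mod_cast D₀.maninConstant_ne_zero_holds
  obtain ⟨w, hw, rfl⟩ := h₀ ω hω
  rwa [mul_div_cancel_left₀ w hc₀]

omit [W₀.IsElliptic] [W₀.IsGloballyMinimal] in
/-- **At `N = 4q` (`q` odd, `(ℤ/q)ˣ` cyclic) the index-`4` configuration `Λ₁(f) = 2Λ₀(f)` is impossible for a
lattice-optimal `X₀(N)`-datum** (E-an-68's hypothesis is vacuous at these levels).  The Shimura quotient has at most two
classes (`exists_forall_mem_or_sub_mem_periodLatticeGamma1_four_mul_of_isNewform0`), but `Λ₀/2Λ₀` has the three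
non-zero classes of `ω₁/c₀, ω₂/c₀, (ω₁+ω₂)/c₀`: two of `0, ω₁/c₀, ω₂/c₀, (ω₁+ω₂)/c₀` would be congruent mod
`2Λ₀ ⊆ 2c₀⁻¹Λ_{E₀}`, putting a half-period `ω₁/2`, `ω₂/2` or `(ω₁ ± ω₂)/2` in `Λ_{E₀}`. -/
theorem not_periodLatticeGamma1_eq_two_mul_of_four_mul (hq : Odd q) [IsCyclic (ZMod q)ˣ]
    (D₀ : ModularParametrizationData W₀ (4 * q))
    (h₀ : ∀ z ∈ D₀.L.lattice, ∃ w ∈ periodLattice D₀.f, z = D₀.c * w) :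
    ¬ (∀ z : ℂ, z ∈ periodLatticeGamma1 D₀.f ↔ ∃ w ∈ periodLattice D₀.f, z = 2 * w) := by
  intro hidx
  have hc₀ : (D₀.c : ℂ) ≠ 0 := by exact_mod_cast D₀.maninConstant_ne_zero_holds
  obtain ⟨γ₀, hγ₀⟩ :=
    exists_forall_mem_or_sub_mem_periodLatticeGamma1_four_mul_of_isNewform0 hq D₀.f D₀.isNewformOf.1
  set L := D₀.L with hL
  -- every `u ∈ Λ₁ = 2Λ₀` has `c₀ u / 2 ∈ Λ_{E₀}`
  have key : ∀ u ∈ periodLatticeGamma1 D₀.f, (D₀.c : ℂ) * u / 2 ∈ L.lattice := by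
    intro u hu
    obtain ⟨w, hw, rfl⟩ := (hidx u).mp hu
    have e : (D₀.c : ℂ) * (2 * w) / 2 = (D₀.c : ℂ) * w := by ring
    rw [e]
    exact D₀.smul_periodLattice_le w hw
  -- the three test periods
  have h1 : L.ω₁ / (D₀.c : ℂ) ∈ periodLattice D₀.f := div_maninConstant_mem_periodLattice_of_optimal D₀ h₀ L.ω₁_mem_lattice
  have h2 : L.ω₂ / (D₀.c : ℂ) ∈ periodLattice D₀.f := div_maninConstant_mem_periodLattice_of_optimal D₀ h₀ L.ω₂_mem_lattice
  have h12 : (L.ω₁ + L.ω₂) / (D₀.c : ℂ) ∈ periodLattice D₀.f := by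
    rw [add_div]; exact add_mem h1 h2
  -- the four forbidden half-periods
  have n1 : L.ω₁ / 2 ∉ L.lattice := L.ω₁_div_two_notMem_lattice
  have n2 : L.ω₂ / 2 ∉ L.lattice := L.ω₂_div_two_notMem_lattice
  have n12 : (L.ω₁ + L.ω₂) / 2 ∉ L.lattice := by
    have h := (L.mul_ω₁_add_mul_ω₂_mem_lattice (α := 1 / 2) (β := 1 / 2)).not.mpr (by norm_num)
    intro hmem; apply h
    convert hmem using 1; push_cast; ring
  have n1m2 : (L.ω₁ - L.ω₂) / 2 ∉ L.lattice := by
    have h := (L.mul_ω₁_add_mul_ω₂_mem_lattice (α := 1 / 2) (β := -(1 / 2))).not.mpr (by norm_num)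
    intro hmem; apply h
    convert hmem using 1; push_cast; ring
  -- case analysis on the three classes
  rcases hγ₀ _ h1 with a1 | a1
  · exact n1 (by simpa [mul_div_cancel₀ _ hc₀, mul_comm] using key _ a1)
  rcases hγ₀ _ h2 with a2 | a2
  · exact n2 (by simpa [mul_div_cancel₀ _ hc₀, mul_comm] using key _ a2)
  rcases hγ₀ _ h12 with a12 | a12
  · exact n12 (by simpa [mul_div_cancel₀ _ hc₀, mul_comm] using key _ a12)
  -- all three ≡ {γ₀}: then ω₁/c₀ − ω₂/c₀ ∈ Λ₁
  have hdiff : L.ω₁ / (D₀.c : ℂ) - L.ω₂ / (D₀.c : ℂ) ∈ periodLatticeGamma1 D₀.f := by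
    have h := sub_mem a1 a2
    have e : L.ω₁ / (D₀.c : ℂ) - cuspSymbol D₀.f γ₀ - (L.ω₂ / (D₀.c : ℂ) - cuspSymbol D₀.f γ₀) =
        L.ω₁ / (D₀.c : ℂ) - L.ω₂ / (D₀.c : ℂ) := by ring
    rwa [e] at h
  refine n1m2 ?_
  have h := key _ hdiff
  have e : (D₀.c : ℂ) * (L.ω₁ / (D₀.c : ℂ) - L.ω₂ / (D₀.c : ℂ)) / 2 = (L.ω₁ - L.ω₂) / 2 := by
    field_simp
  rwa [e] at h

omit [W₀.IsElliptic] [W₀.IsGloballyMinimal] in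
/-- **DICHOTOMY at `N = 4q`**: for a lattice-optimal `X₀(4q)`-datum (`q` odd, `(ℤ/q)ˣ` cyclic) either
`Λ₁(f) = Λ₀(f)` (Stevens' curve is the optimal curve), or the Shimura quotient is `ℤ/2` with an explicit generating
period: `{∞, γ₀∞}_f ∉ Λ₁(f)` and every period is `≡ 0` or `≡ {∞, γ₀∞}_f (mod Λ₁)`. -/
theorem periodLatticeGamma1_eq_or_exists_generator_of_four_mul (hq : Odd q) [IsCyclic (ZMod q)ˣ]
    (D₀ : ModularParametrizationData W₀ (4 * q)) :
    periodLatticeGamma1 D₀.f = periodLattice D₀.f ∨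
      ∃ γ₀ : Gamma0 (4 * q), cuspSymbol D₀.f γ₀ ∉ periodLatticeGamma1 D₀.f ∧
        ∀ z ∈ periodLattice D₀.f,
          z ∈ periodLatticeGamma1 D₀.f ∨ z - cuspSymbol D₀.f γ₀ ∈ periodLatticeGamma1 D₀.f := by
  obtain ⟨γ₀, hγ₀⟩ :=
    exists_forall_mem_or_sub_mem_periodLatticeGamma1_four_mul_of_isNewform0 hq D₀.f D₀.isNewformOf.1
  by_cases hmem : cuspSymbol D₀.f γ₀ ∈ periodLatticeGamma1 D₀.f
  · left
    refine le_antisymm (periodLatticeGamma1_le_periodLattice D₀.f) fun z hz ↦ ?_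
    rcases hγ₀ z hz with h | h
    · exact h
    · have e : z = (z - cuspSymbol D₀.f γ₀) + cuspSymbol D₀.f γ₀ := by ring
      rw [e]; exact add_mem h hmem
  · exact Or.inr ⟨γ₀, hmem, hγ₀⟩

/-- **For the optimal pair of a class at `N = 4q`: `|c₀| = |c₁|`, or `|c₀| = 2|c₁|` with Shimura quotient exactly
`ℤ/2`** (generated by an explicit period `{∞, γ₀∞}_f ∉ Λ₁(f)`).  (`Λ₁ = Λ₀ ⟹ |c₀| = |c₁|` by the homothety engine,
`natAbs_maninConstant₀_eq_of_periodLatticeGamma1_eq_periodLattice`; otherwise the dichotomy's second case, and the ledger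
`|c₀| ∈ {|c₁|, 2|c₁|}`.) -/
theorem natAbs_maninConstant₀_eq_or_index_two_of_four_mul (hq : Odd q) [IsCyclic (ZMod q)ˣ]
    (D₁ : Gamma1ParametrizationData W₁ (4 * q)) (D₀ : ModularParametrizationData W₀ (4 * q))
    (hiso : IsIsogenous W₁ W₀) (h₁ : D₁.IsOptimal)
    (h₀ : ∀ z ∈ D₀.L.lattice, ∃ w ∈ periodLattice D₀.f, z = D₀.c * w) :
    D₀.maninConstant.natAbs = D₁.maninConstant.natAbs ∨
      (D₀.maninConstant.natAbs = 2 * D₁.maninConstant.natAbs ∧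
        ∃ γ₀ : Gamma0 (4 * q), cuspSymbol D₀.f γ₀ ∉ periodLatticeGamma1 D₀.f ∧
          ∀ z ∈ periodLattice D₀.f,
            z ∈ periodLatticeGamma1 D₀.f ∨ z - cuspSymbol D₀.f γ₀ ∈ periodLatticeGamma1 D₀.f) := by
  have hf : D₁.f = D₀.f := D₁.f_eq_of_isIsogenous D₀ hiso
  rcases periodLatticeGamma1_eq_or_exists_generator_of_four_mul hq D₀ with hΛ | hgen
  · exact Or.inl (natAbs_maninConstant₀_eq_of_periodLatticeGamma1_eq_periodLattice D₁ D₀ h₁ h₀ hf hΛ)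
  · rcases natAbs_maninConstant₀_eq_or_eq_two_mul_of_four_dvd_level D₁ D₀ hiso h₁ h₀ ⟨q, rfl⟩ with h | h
    · exact Or.inl h
    · exact Or.inr ⟨h, hgen⟩

/-- **Prime form, `N = 4p` with `p` an odd prime** (the levels of the tame blind family `p = m² + 4`): for the
optimal pair of a class, `|c₀| = |c₁|` or (`|c₀| = 2|c₁|` and the Shimura quotient is `ℤ/2` with an explicit
generating period). -/
theorem natAbs_maninConstant₀_eq_or_index_two_of_four_mul_prime {p : ℕ} (hp : p.Prime) (hp2 : p ≠ 2)
    [NeZero (4 * p)] (D₁ : Gamma1ParametrizationData W₁ (4 * p)) (D₀ : ModularParametrizationData W₀ (4 * p))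
    (hiso : IsIsogenous W₁ W₀) (h₁ : D₁.IsOptimal)
    (h₀ : ∀ z ∈ D₀.L.lattice, ∃ w ∈ periodLattice D₀.f, z = D₀.c * w) :
    D₀.maninConstant.natAbs = D₁.maninConstant.natAbs ∨
      (D₀.maninConstant.natAbs = 2 * D₁.maninConstant.natAbs ∧
        ∃ γ₀ : Gamma0 (4 * p), cuspSymbol D₀.f γ₀ ∉ periodLatticeGamma1 D₀.f ∧
          ∀ z ∈ periodLattice D₀.f,
            z ∈ periodLatticeGamma1 D₀.f ∨ z - cuspSymbol D₀.f γ₀ ∈ periodLatticeGamma1 D₀.f) := by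
  haveI : IsCyclic (ZMod p)ˣ := ZMod.isCyclic_units_prime hp
  exact natAbs_maninConstant₀_eq_or_index_two_of_four_mul (hp.odd_of_ne_two hp2) D₁ D₀ hiso h₁ h₀

omit [W₀.IsElliptic] [W₀.IsGloballyMinimal] in
/-- **Prime form of the index-`4` exclusion**: at `N = 4p`, `p` an odd prime, no lattice-optimal `X₀(N)`-datum has
`Λ₁(f) = 2Λ₀(f)`. -/
theorem not_periodLatticeGamma1_eq_two_mul_of_four_mul_prime {p : ℕ} (hp : p.Prime) (hp2 : p ≠ 2)
    [NeZero (4 * p)] (D₀ : ModularParametrizationData W₀ (4 * p))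
    (h₀ : ∀ z ∈ D₀.L.lattice, ∃ w ∈ periodLattice D₀.f, z = D₀.c * w) :
    ¬ (∀ z : ℂ, z ∈ periodLatticeGamma1 D₀.f ↔ ∃ w ∈ periodLattice D₀.f, z = 2 * w) := by
  haveI : IsCyclic (ZMod p)ˣ := ZMod.isCyclic_units_prime hp
  exact not_periodLatticeGamma1_eq_two_mul_of_four_mul (hp.odd_of_ne_two hp2) D₀ h₀

end Summit.BirchSwinnertonDyer.BirchSwinnertonDyer.Theorems.ManinLocalTwoThree

end
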